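import Summits.ValiantsHypothesis.ValiantsHypothesis.Theorems.KPlusLogSqLawTropicalBRefreshExclusivity

/-!
# Route «KPlusLogSqLaw», crux `TropicalB` (stmt-ValiantsHypothesis-19771) — the HALF-THIN LAW
# `2·(T(m,K) + 1) ≤ 2·m! + (m!·m + m²)·(K − 1)` and the `m = 3` row `T(3,K) ≤ ⌊(27K − 17)/2⌋`

HONEST FRAMING.  Helper toward the crux `Summit.ValiantsHypothesis.ValiantsHypothesis.Theses.KPlusLogSqLaw.TropicalB` (ledger item
`stmt-ValiantsHypothesis-19771`, registered stubs `stub_tropThin` / `stub_tropFat` of `Cruxes/TropicalB/Lines/birth.lean`; cell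
`pub-symmetroid`, seat val-sym-trop-p4 g4, 2026-08-26; `--supports … --as helper`).  Counting part of the REFRESH-EXCLUSIVITY package
(structure part: `KPlusLogSqLawTropicalBRefreshExclusivity.lean`, imported).  An upper bound in the SUPER-FAT corner `K ≫ m` (fixed size,
many classes), i.e. OFF the window `⌊log₂ m⌋ + 1 < K < m` where the crux lives; nothing here bears on `TropicalB` in the window, on
`WeakLifting` / `Lifting`, on the cell's real census / DoorA26 / DoorA34, on `MatrixDescartes` (stmt-ValiantsHypothesis-18050) or on VP ≠ VNP.
Write `T(m,K)` for the least `B` with `TropRootLawAt m K B` (maximal number of sign changes of a dominant chain).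

* HALF-THIN LAW (`two_mul_succ_le_card_perms`, `tropRootLawAt_halfThin`): a sign-alternating dominant chain of `n + 1` terms that uses the
  set `Π` of permutations satisfies `2(n+1) ≤ (2 + m(K−1))·|Π| + m²(K−1)`, hence `T(m,K) + 1 ≤ m! + (m!·m + m²)(K−1)/2`: the `K`-slope of
  the thin law `T(m,K) + 1 ≤ m!·(m(K−1)+1)` (`tropRootLawAt_thin`; per-permutation form `n + 1 ≤ |Π|·(m(K−1)+1)`, `succ_le_card_perms_mul`,
  p419330) is HALVED for every `m ≥ 3` — recycling of permutations is at most half efficient.  (For `m = 2` two distinct permutations share no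
  cell and the bound is the thin law's `4K − 2`, consistent with `T(2,K) = 4K − 7`, p443198.)
  Bookkeeping: `n + 1 = #(first uses) + #steps ≤ |Π| + #steps` (a STEP = two consecutive uses `i < k` of one permutation); a step changes the
  class of `r ≥ 1` cells of its permutation (`chain_ne`); TIGHT steps (`r = 1`) number `≤ m²(K−1)` (`card_tight_le`: per cell, the new classes
  of the tight steps switching it are pairwise distinct by REFRESH EXCLUSIVITY `refresh_exclusive` and all differ from the cell's class at the
  earliest of them); the total change mass is `≤ (K−1)·m·|Π|` (`sum_card_chg_le`: per permutation and column the class moves up at most `K−1`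
  times); and `2·#steps ≤ #tight + mass`.
* THE `m = 3` ROW (`tropRootLawAt_three_halfThin`): `T(3,K) ≤ 5 + ⌊27(K−1)/2⌋ = ⌊(27K − 17)/2⌋`.  Against the row of record
  `6K − 11 ≤ T(3,K) ≤ min(C(K+2,3) − 1, 18K − 53)` (p451561, val-sym-trop-p4 g3; lower side python only) this is the best upper bound for
  every `K ≥ 10` (`three_halfThin_lt_threeSharp`, `three_halfThin_lt_counting`), and it answers the lineage's question «is the thin-law slope
  `3!·3 = 18` the true slope of the `m = 3` row, as `2!·2 = 4` is for `m = 2`?» in the negative: `limsup T(3,K)/K ≤ 13.5`.  It also explains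
  val-sym-trop-p4 g3's located fact (THREE-ROW-g3.md §2) that LIS-optimal entry-firing schedules (reaching `18K − 56`) were LP-infeasible:
  the firing model ignores refresh exclusivity.

SUCCESSOR NOTE (not proved here): with the changed-cell-set form of exclusivity («the steps whose changed cell-set is exactly the partial
permutation `C` number `≤ K − 1`, for every `C`») the same bookkeeping gives, for every `R ≥ 1`,
`(R+1)(n+1) ≤ (R+1)|Π| + (K−1)·Σ_{r ≤ R} (R+1−r)·N_r + m(K−1)|Π|` with `N_r = C(m,r)²·r!` (`R = 1` is this file); optimising `R` gives
`T(m,K) + 1 = O(m!·K)`, a factor `Θ(m)` below the thin law (`R = 2` first helps at `m = 5`: `283(K−1)` vs `312(K−1)` here vs `600(K−1)` thin).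
[this cell]
-/

-- `Summit.ValiantsHypothesis.ValiantsHypothesis.…` repeats a component by the D-0017 layout
-- (single-conjunct summit), which the `dupNamespace` linter flags; the name is mandated.
set_option linter.dupNamespace false
set_option autoImplicit false

namespace Summit.ValiantsHypothesis.ValiantsHypothesis.Theorems.KPlusLogSqLaw

open Summit.ValiantsHypothesis.ValiantsHypothesis.Theorems.MatrixDescartes.Negative
open Summit.ValiantsHypothesis.ValiantsHypothesis.Theorems.LacunarySymmetroidMatrixDescartes.TropicalCensus
open Finset

namespace RefreshExclusivity

/-! ## 3. Counting -/

section Chain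

variable {m K n : ℕ} (d : Fin K → ℕ) (v ε : Fin m → Fin m → Fin K → ℤ) (θ : Fin (n + 1) → ℤ)
  (p : Fin (n + 1) → Equiv.Perm (Fin m) × (Fin m → Fin K))


/-- Per cell `(a,b)`: among tight steps whose switched cell is `(a,b)`, at most `K − 1` (their new classes are pairwise distinct by
refresh exclusivity and all differ from the class of the cell at the earliest of these steps). -/
theorem card_cellFibre_le (hθ : StrictMono θ) (hdom : ∀ k, IsDominant d v ε (θ k) (p k))
    (G : Finset (Fin (n + 1) × Fin (n + 1)))
    (hG : ∀ ik ∈ G, ik.1 < ik.2 ∧ (p ik.1).1 = (p ik.2).1 ∧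
      (∀ j, ik.1 < j → j < ik.2 → (p j).1 ≠ (p ik.2).1) ∧
      (univ.filter fun b => (p ik.1).2 b ≠ (p ik.2).2 b).card = 1) (a b : Fin m) :
    (G.filter fun ik => (p ik.2).1 b = a ∧ (p ik.1).2 b ≠ (p ik.2).2 b).card ≤ K - 1 := by
  classical
  -- tight steps agree off their switched column
  have hoff : ∀ ik ∈ G, (p ik.1).2 b ≠ (p ik.2).2 b → ∀ b', b' ≠ b → (p ik.1).2 b' = (p ik.2).2 b' := by
    intro ik hik hb b' hb'
    obtain ⟨c, hc⟩ := Finset.card_eq_one.mp (hG ik hik).2.2.2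
    have hbc : b = c := by
      have hm : b ∈ univ.filter fun b => (p ik.1).2 b ≠ (p ik.2).2 b := Finset.mem_filter.mpr ⟨mem_univ _, hb⟩
      rw [hc] at hm
      exact Finset.mem_singleton.mp hm
    by_contra hne
    have hm : b' ∈ univ.filter fun b => (p ik.1).2 b ≠ (p ik.2).2 b := Finset.mem_filter.mpr ⟨mem_univ _, hne⟩
    rw [hc, Finset.mem_singleton] at hm
    exact hb' (hm.trans hbc.symm)
  have hmem : ∀ ik ∈ (G.filter fun ik => (p ik.2).1 b = a ∧ (p ik.1).2 b ≠ (p ik.2).2 b),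
      ik ∈ G ∧ (p ik.2).1 b = a ∧ (p ik.1).2 b ≠ (p ik.2).2 b := fun ik hik => by
    simpa only [Finset.mem_filter] using hik
  rcases (G.filter fun ik => (p ik.2).1 b = a ∧ (p ik.1).2 b ≠ (p ik.2).2 b).eq_empty_or_nonempty with h0 | hne
  · rw [h0, Finset.card_empty]
    exact Nat.zero_le _
  obtain ⟨x₀, hx₀, hmin⟩ :=
    (G.filter fun ik => (p ik.2).1 b = a ∧ (p ik.1).2 b ≠ (p ik.2).2 b).exists_min_image Prod.fst hne
  obtain ⟨hG₀, ha₀, -⟩ := hmem x₀ hx₀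
  obtain ⟨hlt₀, hperm₀, -, -⟩ := hG x₀ hG₀
  calc (G.filter fun ik => (p ik.2).1 b = a ∧ (p ik.1).2 b ≠ (p ik.2).2 b).card
      ≤ (univ.erase ((p x₀.1).2 b)).card := by
        refine Finset.card_le_card_of_injOn (fun ik => (p ik.2).2 b) (fun x hx => ?_) (fun x hx x' hx' hxx' => ?_)
        · obtain ⟨hGx, hax, hchgx⟩ := hmem x hx
          obtain ⟨hltx, hpermx, -, -⟩ := hG x hGx
          have hi : x₀.1 ≤ x.1 := hmin x hx
          have e1 : d ((p x₀.1).2 b) ≤ d ((p x.1).2 b) :=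
            d_le_of_cell d v ε θ p hθ hdom hi b (by rw [hpermx, hax, hperm₀, ha₀])
          have e2 : d ((p x.1).2 b) < d ((p x.2).2 b) :=
            d_lt_of_cell d v ε θ p hθ hdom hltx b (by rw [hpermx]) hchgx
          have hfx : (p x.2).2 b ≠ (p x₀.1).2 b := by
            intro h
            rw [h] at e2
            exact lt_irrefl _ (e1.trans_lt e2)
          exact Finset.mem_coe.mpr (Finset.mem_erase.mpr ⟨hfx, mem_univ _⟩)
        · obtain ⟨hGx, hax, hchgx⟩ := hmem x hx
          obtain ⟨hltx, hpermx, hbtwx, -⟩ := hG x hGx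
          obtain ⟨hGx', hax', hchgx'⟩ := hmem x' hx'
          obtain ⟨hltx', hpermx', hbtwx', -⟩ := hG x' hGx'
          have hk : x.2 = x'.2 :=
            refresh_exclusive d v ε θ p hθ hdom b hltx hpermx hbtwx hltx' hpermx' hbtwx'
              (hoff x hGx hchgx) (hoff x' hGx' hchgx') hchgx hchgx' (by rw [hax, hax']) (Eq.symm hxx')
          have hi : x.1 = x'.1 :=
            step_fst_unique p hltx hpermx hbtwx (by rw [hk]; exact hltx') (by rw [hk]; exact hpermx')
              (by rw [hk]; exact hbtwx')
          exact Prod.ext hi hk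
    _ = K - 1 := by rw [Finset.card_erase_of_mem (mem_univ _), Finset.card_univ, Fintype.card_fin]

/-- **At most `m²(K−1)` tight steps** in any family of steps whose class vectors change at exactly one column. -/
theorem card_tight_le (hθ : StrictMono θ) (hdom : ∀ k, IsDominant d v ε (θ k) (p k))
    (G : Finset (Fin (n + 1) × Fin (n + 1)))
    (hG : ∀ ik ∈ G, ik.1 < ik.2 ∧ (p ik.1).1 = (p ik.2).1 ∧
      (∀ j, ik.1 < j → j < ik.2 → (p j).1 ≠ (p ik.2).1) ∧
      (univ.filter fun b => (p ik.1).2 b ≠ (p ik.2).2 b).card = 1) :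
    G.card ≤ m ^ 2 * (K - 1) := by
  classical
  have hcover : G ⊆ (univ : Finset (Fin m × Fin m)).biUnion fun ab =>
      G.filter fun ik => (p ik.2).1 ab.2 = ab.1 ∧ (p ik.1).2 ab.2 ≠ (p ik.2).2 ab.2 := by
    intro ik hik
    obtain ⟨c, hc⟩ := Finset.card_eq_one.mp (hG ik hik).2.2.2
    have hcm : c ∈ univ.filter fun b => (p ik.1).2 b ≠ (p ik.2).2 b := by
      rw [hc]; exact Finset.mem_singleton_self c
    rw [Finset.mem_filter] at hcm
    exact Finset.mem_biUnion.mpr ⟨((p ik.2).1 c, c), mem_univ _, Finset.mem_filter.mpr ⟨hik, rfl, hcm.2⟩⟩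
  calc G.card ≤ ((univ : Finset (Fin m × Fin m)).biUnion fun ab =>
        G.filter fun ik => (p ik.2).1 ab.2 = ab.1 ∧ (p ik.1).2 ab.2 ≠ (p ik.2).2 ab.2).card :=
        Finset.card_le_card hcover
    _ ≤ ∑ ab ∈ (univ : Finset (Fin m × Fin m)),
          (G.filter fun ik => (p ik.2).1 ab.2 = ab.1 ∧ (p ik.1).2 ab.2 ≠ (p ik.2).2 ab.2).card :=
        Finset.card_biUnion_le
    _ ≤ ∑ _ab ∈ (univ : Finset (Fin m × Fin m)), (K - 1) :=
        Finset.sum_le_sum fun ab _ => card_cellFibre_le d v ε θ p hθ hdom G hG ab.1 ab.2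
    _ = m ^ 2 * (K - 1) := by
        rw [Finset.sum_const, smul_eq_mul, Finset.card_univ, Fintype.card_prod, Fintype.card_fin, sq]

/-- Per (permutation, column): the change mass of the steps of a fixed permutation `σ` at a fixed column `b` is at most `K − 1`
(the new classes are pairwise distinct and differ from the class at the earliest of these steps). -/
theorem card_permFibre_le (hθ : StrictMono θ) (hdom : ∀ k, IsDominant d v ε (θ k) (p k))
    (G : Finset (Fin (n + 1) × Fin (n + 1)))
    (hG : ∀ ik ∈ G, ik.1 < ik.2 ∧ (p ik.1).1 = (p ik.2).1 ∧ ∀ j, ik.1 < j → j < ik.2 → (p j).1 ≠ (p ik.2).1)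
    (σ : Equiv.Perm (Fin m)) (b : Fin m) :
    ((G.sigma fun ik => univ.filter fun b => (p ik.1).2 b ≠ (p ik.2).2 b).filter
      fun x => ((p x.1.2).1, x.2) = (σ, b)).card ≤ K - 1 := by
  classical
  have hmem : ∀ x ∈ ((G.sigma fun ik => univ.filter fun b => (p ik.1).2 b ≠ (p ik.2).2 b).filter
      fun x => ((p x.1.2).1, x.2) = (σ, b)),
      x.1 ∈ G ∧ (p x.1.1).2 x.2 ≠ (p x.1.2).2 x.2 ∧ (p x.1.2).1 = σ ∧ x.2 = b := by
    intro x hx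
    have hx' := Finset.mem_filter.mp hx
    have hx1 := Finset.mem_sigma.mp hx'.1
    have hx2 := Finset.mem_filter.mp hx1.2
    exact ⟨hx1.1, hx2.2, (Prod.mk.inj hx'.2).1, (Prod.mk.inj hx'.2).2⟩
  rcases ((G.sigma fun ik => univ.filter fun b => (p ik.1).2 b ≠ (p ik.2).2 b).filter
      fun x => ((p x.1.2).1, x.2) = (σ, b)).eq_empty_or_nonempty with h0 | hne
  · rw [h0, Finset.card_empty]
    exact Nat.zero_le _
  obtain ⟨x₀, hx₀, hmin⟩ := Finset.exists_min_image _ (fun x => x.1.2) hne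
  obtain ⟨hG₀, -, hσ₀, -⟩ := hmem x₀ hx₀
  obtain ⟨hlt₀, hperm₀, -⟩ := hG x₀.1 hG₀
  calc ((G.sigma fun ik => univ.filter fun b => (p ik.1).2 b ≠ (p ik.2).2 b).filter
        fun x => ((p x.1.2).1, x.2) = (σ, b)).card
      ≤ (univ.erase ((p x₀.1.1).2 b)).card := by
        refine Finset.card_le_card_of_injOn (fun x => (p x.1.2).2 b) (fun x hx => ?_) (fun x hx x' hx' hxx' => ?_)
        · obtain ⟨hGx, hchgx, hσx, hbx⟩ := hmem x hx
          obtain ⟨hltx, hpermx, hbtwx⟩ := hG x.1 hGx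
          have hk : x₀.1.2 ≤ x.1.2 := hmin x hx
          have hi : x₀.1.1 ≤ x.1.1 := by
            by_contra h
            push Not at h
            exact hbtwx x₀.1.1 h (hlt₀.trans_le hk) (by rw [hperm₀, hσ₀, hσx])
          have e1 : d ((p x₀.1.1).2 b) ≤ d ((p x.1.1).2 b) :=
            d_le_of_cell d v ε θ p hθ hdom hi b (by rw [hpermx, hσx, hperm₀, hσ₀])
          have e2 : d ((p x.1.1).2 b) < d ((p x.1.2).2 b) :=
            d_lt_of_cell d v ε θ p hθ hdom hltx b (by rw [hpermx]) (by rw [← hbx]; exact hchgx)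
          have hfx : (p x.1.2).2 b ≠ (p x₀.1.1).2 b := by
            intro h
            rw [h] at e2
            exact lt_irrefl _ (e1.trans_lt e2)
          exact Finset.mem_coe.mpr (Finset.mem_erase.mpr ⟨hfx, mem_univ _⟩)
        · obtain ⟨hGx, hchgx, hσx, hbx⟩ := hmem x hx
          obtain ⟨hltx, hpermx, hbtwx⟩ := hG x.1 hGx
          obtain ⟨hGx', hchgx', hσx', hbx'⟩ := hmem x' hx'
          obtain ⟨hltx', hpermx', hbtwx'⟩ := hG x'.1 hGx'
          have hb : (p x.1.1).2 b ≠ (p x.1.2).2 b := by rw [← hbx]; exact hchgx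
          have hb' : (p x'.1.1).2 b ≠ (p x'.1.2).2 b := by rw [← hbx']; exact hchgx'
          have hσσ : (p x.1.2).1 = (p x'.1.2).1 := by rw [hσx, hσx']
          have heq : (p x.1.2).2 b = (p x'.1.2).2 b := hxx'
          have hk : x.1.2 = x'.1.2 := by
            rcases lt_trichotomy x.1.2 x'.1.2 with h | h | h
            · have := d_lt_of_steps_lt d v ε θ p hθ hdom b hltx' hpermx' hbtwx' hσσ h hb'
              rw [heq] at this
              exact absurd this (lt_irrefl _)
            · exact h
            · have := d_lt_of_steps_lt d v ε θ p hθ hdom b hltx hpermx hbtwx hσσ.symm h hb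
              rw [heq] at this
              exact absurd this (lt_irrefl _)
          have hi : x.1.1 = x'.1.1 :=
            step_fst_unique p hltx hpermx hbtwx (by rw [hk]; exact hltx') (by rw [hk]; exact hpermx')
              (by rw [hk]; exact hbtwx')
          obtain ⟨⟨i, k⟩, c⟩ := x
          obtain ⟨⟨i', k'⟩, c'⟩ := x'
          simp only at hi hk hbx hbx'
          subst hi hk hbx hbx'
          rfl
    _ = K - 1 := by rw [Finset.card_erase_of_mem (mem_univ _), Finset.card_univ, Fintype.card_fin]

/-- **Change mass ≤ m(K−1)·|Π|**: summed over a family of steps, the number of changed columns is at most `(K−1)·(|Π|·m)`. -/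
theorem sum_card_chg_le (hθ : StrictMono θ) (hdom : ∀ k, IsDominant d v ε (θ k) (p k))
    (G : Finset (Fin (n + 1) × Fin (n + 1)))
    (hG : ∀ ik ∈ G, ik.1 < ik.2 ∧ (p ik.1).1 = (p ik.2).1 ∧ ∀ j, ik.1 < j → j < ik.2 → (p j).1 ≠ (p ik.2).1) :
    ∑ ik ∈ G, (univ.filter fun b => (p ik.1).2 b ≠ (p ik.2).2 b).card ≤
      (K - 1) * ((univ.image fun k => (p k).1).card * m) := by
  classical
  rw [← Finset.card_sigma]
  have ht : ((univ.image fun k => (p k).1) ×ˢ (univ : Finset (Fin m))).card =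
      (univ.image fun k => (p k).1).card * m := by
    rw [Finset.card_product, Finset.card_univ, Fintype.card_fin]
  rw [← ht]
  refine Finset.card_le_mul_card_image_of_maps_to (f := fun x => ((p x.1.2).1, x.2)) (fun x _ => ?_) (K - 1)
    (fun y _ => ?_)
  · exact Finset.mem_product.mpr ⟨Finset.mem_image.mpr ⟨x.1.2, mem_univ _, rfl⟩, mem_univ _⟩
  · obtain ⟨σ, b⟩ := y
    exact card_permFibre_le d v ε θ p hθ hdom G hG σ b

/-- **HALF-THIN LAW, permutation-count form.**  A sign-alternating dominant chain of `n + 1` terms using the set `Π` of permutations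
satisfies `2(n+1) ≤ (2 + m(K−1))·|Π| + m²(K−1)` — versus the per-permutation bound `n + 1 ≤ (1 + m(K−1))·|Π|`
(`succ_le_card_perms_mul`, val-sym-lift-p2): recycling is at most half efficient. [this cell, val-sym-trop-p4 g4] -/
theorem two_mul_succ_le_card_perms (hθ : StrictMono θ) (hdom : ∀ k, IsDominant d v ε (θ k) (p k))
    (halt : ∀ k : Fin n, termSign ε (p k.castSucc) * termSign ε (p k.succ) < 0) :
    2 * (n + 1) ≤ (2 + m * (K - 1)) * (univ.image fun k => (p k).1).card + m ^ 2 * (K - 1) := by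
  classical
  -- steps: consecutive uses of a permutation
  set St : Finset (Fin (n + 1) × Fin (n + 1)) := univ.filter fun ik =>
      ik.1 < ik.2 ∧ (p ik.1).1 = (p ik.2).1 ∧ ∀ j, ik.1 < j → j < ik.2 → (p j).1 ≠ (p ik.2).1 with hSt
  have hStmem : ∀ ik, ik ∈ St ↔
      ik.1 < ik.2 ∧ (p ik.1).1 = (p ik.2).1 ∧ ∀ j, ik.1 < j → j < ik.2 → (p j).1 ≠ (p ik.2).1 := by
    intro ik
    rw [hSt, Finset.mem_filter]
    exact ⟨fun h => h.2, fun h => ⟨mem_univ _, h⟩⟩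
  -- first uses
  set NP : Finset (Fin (n + 1)) := univ.filter fun k => ∀ i, i < k → (p i).1 ≠ (p k).1 with hNP
  have hNPmem : ∀ k, k ∈ NP ↔ ∀ i, i < k → (p i).1 ≠ (p k).1 := by
    intro k
    rw [hNP, Finset.mem_filter]
    exact ⟨fun h => h.2, fun h => ⟨mem_univ _, h⟩⟩
  -- (1) every position is a first use or the later endpoint of a step
  have h1 : ∀ k : Fin (n + 1), k ∈ NP ∨ ∃ i, (i, k) ∈ St := by
    intro k
    by_cases h : ∃ i, i < k ∧ (p i).1 = (p k).1
    · right
      obtain ⟨i₀, hi₀⟩ := h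
      set S : Finset (Fin (n + 1)) := univ.filter fun i => i < k ∧ (p i).1 = (p k).1 with hS
      have hSmem : ∀ i, i ∈ S ↔ i < k ∧ (p i).1 = (p k).1 := by
        intro i
        rw [hS, Finset.mem_filter]
        exact ⟨fun h => h.2, fun h => ⟨mem_univ _, h⟩⟩
      have hSne : S.Nonempty := ⟨i₀, (hSmem i₀).2 hi₀⟩
      obtain ⟨hlt, hperm⟩ := (hSmem _).1 (S.max'_mem hSne)
      refine ⟨S.max' hSne, (hStmem _).2 ⟨hlt, hperm, fun j hj hjk heq => ?_⟩⟩
      exact absurd (S.le_max' j ((hSmem j).2 ⟨hjk, heq⟩)) (not_le.mpr hj)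
    · left
      push Not at h
      exact (hNPmem k).2 h
  -- (2) `n + 1 ≤ |NP| + |St|`
  have h2 : n + 1 ≤ NP.card + St.card := by
    have hsub : (univ : Finset (Fin (n + 1))) ⊆ NP ∪ St.image Prod.snd := by
      intro k _
      rcases h1 k with h | ⟨i, hi⟩
      · exact Finset.mem_union_left _ h
      · exact Finset.mem_union_right _ (Finset.mem_image.mpr ⟨(i, k), hi, rfl⟩)
    calc n + 1 = (univ : Finset (Fin (n + 1))).card := by rw [Finset.card_univ, Fintype.card_fin]
      _ ≤ (NP ∪ St.image Prod.snd).card := Finset.card_le_card hsub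
      _ ≤ NP.card + (St.image Prod.snd).card := Finset.card_union_le _ _
      _ ≤ NP.card + St.card := Nat.add_le_add_left Finset.card_image_le _
  -- (3) first uses are at most the distinct permutations
  have h3 : NP.card ≤ (univ.image fun k => (p k).1).card := by
    refine Finset.card_le_card_of_injOn (fun k => (p k).1)
      (fun k _ => Finset.mem_image.mpr ⟨k, mem_univ _, rfl⟩) ?_
    intro k hk k' hk' hkk'
    by_contra hne
    rcases lt_or_gt_of_ne hne with h | h
    · exact (hNPmem k').1 hk' k h hkk'
    · exact (hNPmem k).1 hk k' h (Eq.symm hkk')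
  -- (4) a step changes at least one column (chain terms are distinct)
  have h4 : ∀ ik ∈ St, 1 ≤ (univ.filter fun b => (p ik.1).2 b ≠ (p ik.2).2 b).card := by
    intro ik hik
    obtain ⟨hlt, hperm, -⟩ := (hStmem ik).1 hik
    rw [Nat.one_le_iff_ne_zero, Ne, Finset.card_eq_zero, Finset.filter_eq_empty_iff]
    intro hall
    apply chain_ne d v ε θ p hθ hdom halt hlt
    exact Prod.ext hperm (funext fun b => by
      by_contra hb
      exact hall (mem_univ b) hb)
  -- (5) `2·#steps ≤ #tight + change mass`
  have h5 : 2 * St.card ≤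
      (St.filter fun ik => (univ.filter fun b => (p ik.1).2 b ≠ (p ik.2).2 b).card = 1).card +
      ∑ ik ∈ St, (univ.filter fun b => (p ik.1).2 b ≠ (p ik.2).2 b).card := by
    have hTS : (St.filter fun ik => (univ.filter fun b => (p ik.1).2 b ≠ (p ik.2).2 b).card = 1).card =
        ∑ ik ∈ St, if (univ.filter fun b => (p ik.1).2 b ≠ (p ik.2).2 b).card = 1 then 1 else 0 :=
      Finset.card_filter _ _
    have h2S : 2 * St.card = ∑ _ik ∈ St, 2 := by rw [Finset.sum_const, smul_eq_mul, mul_comm]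
    rw [hTS, h2S, ← Finset.sum_add_distrib]
    refine Finset.sum_le_sum fun ik hik => ?_
    have := h4 ik hik
    split_ifs <;> omega
  -- (6) change mass, (7) tight steps
  have h6 := sum_card_chg_le d v ε θ p hθ hdom St (fun ik hik => (hStmem ik).1 hik)
  have h7 := card_tight_le d v ε θ p hθ hdom
    (St.filter fun ik => (univ.filter fun b => (p ik.1).2 b ≠ (p ik.2).2 b).card = 1)
    (fun ik hik => by
      obtain ⟨h, hc⟩ := Finset.mem_filter.mp hik
      obtain ⟨ha, hb, hc'⟩ := (hStmem ik).1 h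
      exact ⟨ha, hb, hc', hc⟩)
  calc 2 * (n + 1) ≤ 2 * NP.card + 2 * St.card := by omega
    _ ≤ 2 * (univ.image fun k => (p k).1).card +
        (m ^ 2 * (K - 1) + (K - 1) * ((univ.image fun k => (p k).1).card * m)) := by omega
    _ = (2 + m * (K - 1)) * (univ.image fun k => (p k).1).card + m ^ 2 * (K - 1) := by ring

end Chain

/-! ## 4. The census rows -/

/-- **HALF-THIN LAW** (all formats): `T(m,K) ≤ m! − 1 + ⌊(m!·m + m²)(K−1)/2⌋`, i.e. `2(T(m,K)+1) ≤ 2·m! + (m!·m + m²)(K−1)`.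
Thin law for comparison: `T(m,K) + 1 ≤ m!·(m(K−1) + 1)` (`tropRootLawAt_thin`).  A super-fat-corner bound (relevant for `K ≫ m`); off the
window of the crux. [this cell, val-sym-trop-p4 g4] -/
theorem tropRootLawAt_halfThin (m K : ℕ) :
    TropRootLawAt m K (m.factorial - 1 + (m.factorial * m + m ^ 2) * (K - 1) / 2) := by
  intro d v ε n θ p _hε hθ hdom halt
  classical
  have h := two_mul_succ_le_card_perms d v ε θ p hθ hdom halt
  have hPi : (univ.image fun k => (p k).1).card ≤ m.factorial :=
    (Finset.card_le_univ _).trans (le_of_eq (by rw [Fintype.card_perm, Fintype.card_fin]))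
  have h2 : 2 * (n + 1) ≤ 2 * m.factorial + (m.factorial * m + m ^ 2) * (K - 1) := by
    calc 2 * (n + 1) ≤ (2 + m * (K - 1)) * (univ.image fun k => (p k).1).card + m ^ 2 * (K - 1) := h
      _ ≤ (2 + m * (K - 1)) * m.factorial + m ^ 2 * (K - 1) :=
          Nat.add_le_add_right (Nat.mul_le_mul_left _ hPi) _
      _ = 2 * m.factorial + (m.factorial * m + m ^ 2) * (K - 1) := by ring
  have hf : 1 ≤ m.factorial := m.factorial_pos
  omega

/-- **The `m = 3` row:** `T(3,K) ≤ 5 + ⌊27(K−1)/2⌋ = ⌊(27K − 17)/2⌋` for `K ≥ 1`; the best known upper bound for `K ≥ 10`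
(slope counting `C(K+2,3) − 1` is smaller up to `K = 7`, the rank-profile row `18K − 53` of p451561 at `K = 8, 9`).
[this cell, val-sym-trop-p4 g4] -/
theorem tropRootLawAt_three_halfThin (K : ℕ) : TropRootLawAt 3 K (5 + 27 * (K - 1) / 2) := by
  refine tropRootLawAt_mono (le_of_eq ?_) (tropRootLawAt_halfThin 3 K)
  simp [Nat.factorial]

/-- Arithmetic remark: from `K = 10` on the half-thin `m = 3` row is below the rank-profile row `18K − 53` (p451561). -/
theorem three_halfThin_lt_threeSharp {K : ℕ} (hK : 10 ≤ K) : 5 + 27 * (K - 1) / 2 < 18 * K - 53 := by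
  omega

/-- Arithmetic remark: from `K = 8` on the half-thin `m = 3` row is below slope counting `C(K+2,3) − 1`
(`6·(5 + ⌊27(K−1)/2⌋) < 6·(C(K+2,3) − 1) = (K+2)(K+1)K − 6`). -/
theorem three_halfThin_lt_counting {K : ℕ} (hK : 8 ≤ K) : 6 * (5 + 27 * (K - 1) / 2) + 6 < (K + 2) * (K + 1) * K := by
  have h1 : 6 * (5 + 27 * (K - 1) / 2) + 6 ≤ 81 * K - 45 := by omega
  have h2 : 81 * K ≤ (K + 2) * (K + 1) * K := by
    have : 81 ≤ (K + 2) * (K + 1) := by nlinarith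
    calc 81 * K ≤ ((K + 2) * (K + 1)) * K := Nat.mul_le_mul_right K this
      _ = (K + 2) * (K + 1) * K := by ring
  omega

end RefreshExclusivity

end Summit.ValiantsHypothesis.ValiantsHypothesis.Theorems.KPlusLogSqLaw
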